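import Mathlib
import Summits.Ventures.HodgeRepro.Tier4.Target
import Summits.Ventures.HodgeRepro.Tier4.Line3.Defs
import Summits.Ventures.HodgeRepro.Tier4.Line3.DefsLemmas
import Summits.Ventures.HodgeRepro.Tier4.Line3.KMDatum
import Summits.Ventures.HodgeRepro.Tier4.Line3.KMDatumS
import Summits.Ventures.HodgeRepro.Tier4.Line3.HeckeEquivarianceLemmas
import Summits.Ventures.HodgeRepro.Tier4.Line3.ClassBoundGauss
import Summits.Ventures.HodgeRepro.Tier4.Line3.UnitCopyScaling
import Summits.Ventures.HodgeRepro.Tier4.Line3.UnitCopyPos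
import Summits.Ventures.HodgeRepro.Tier4.Line3.CopyRemainder
import Summits.Ventures.HodgeRepro.Tier4.Line3.GaussRatioFormula

/-!
# Tier4/Line3/CopyWeightBound — the `N`-free weight of a copy with non-shrinking scalars at `τ₀`, against the main term

Blind re-derivation cell `pub-hodge-repro`, Tier 4 «PROVE THE STEP», LINE L3, seat t4-L3-p2 (g2).  For the archimedean count
`ArchCopyBound` (CopyRemainder p682977) one needs the weight `CopyData.weight c o = ‖∫_𝔹 kernelScale · kernel xm‖ · ‖Λ‖ · gaussRatio`
of a copy against the main term `Re I_∞(xm) = ∫_𝔹 kernel xm`.  For a copy whose scalars do not shrink at `τ₀` (`‖τ₀ ε_j‖ ≥ 1`) the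
kernel factor is bounded by `∏_j ‖τ₀ ε_j‖²` on the ball (`maj ≥ 0`, ClassBoundGauss `maj_nonneg'`), and the kernel of the symmetric
centre is `|wedge|² ≥ 0` (UnitCopyPos `kernel_symm`), so

  `weight c o ≤ (∏_j ‖τ₀ ε_j‖²) · ‖Λ(o)‖ · exp(−π · defSize ε xm) · Re I_∞(xm)`

(`weight_le_of_one_le_norm`): the integral disappears and `ArchCopyBound` on these copies becomes a pure sum over the scalars,
`Σ (∏ ‖τ₀ ε_j‖²) ‖Λ‖ exp(−π defSize) ≤ θ₁`.  The copies with a shrinking scalar at `τ₀` need the coercivity of `maj` against the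
kernel's own Gaussian and are not treated here.

Nothing here says anything about the status of the Hodge conjecture for CM abelian varieties, which is NOT proved
(HC_CM is NOT proved by anyone in this repository).
-/

set_option autoImplicit false

noncomputable section

namespace Summit.Ventures.HodgeRepro.Tier4.Line3

open Summit.Ventures.HodgeRepro.Tier4
open Matrix NumberField MeasureTheory
open scoped ComplexConjugate

namespace T4Data

variable (X : T4Data)

/-- On the ball, the kernel scaling factor of a copy with `‖τ₀ ε_j‖ ≥ 1` is at most `∏_j ‖τ₀ ε_j‖²`. -/
theorem kernelScale_le_of_one_le_norm {ε : Fin 4 → X.E} (hε : ∀ j, 1 ≤ ‖X.τ₀ (ε j)‖) (x : X.Tuple) {z : Fin 2 → ℂ}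
    (hz : z ∈ ball) : X.kernelScale ε x z ≤ ∏ j, ‖X.τ₀ (ε j)‖ ^ 2 := by
  unfold kernelScale
  refine Finset.prod_le_prod (fun j _ => mul_nonneg (pow_nonneg (norm_nonneg _) 2) (Real.exp_pos _).le) fun j _ => ?_
  refine mul_le_of_le_one_right (pow_nonneg (norm_nonneg _) 2) (Real.exp_le_one_iff.2 ?_)
  have h1 : 0 ≤ ‖X.τ₀ (ε j)‖ ^ 2 - 1 := by nlinarith [hε j, norm_nonneg (X.τ₀ (ε j))]
  have h2 : 0 ≤ maj (X.ballCoord (x j)) z := maj_nonneg' _ _ hz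
  nlinarith [Real.pi_pos, mul_nonneg h1 h2]

/-- The norm of the kernel of a symmetric tuple is its real part. -/
theorem norm_kernel_symm (Φ : KMDatumS) (y : X.Tuple) (h02 : y 2 = y 0) (h13 : y 3 = y 1) (z : Fin 2 → ℂ) :
    ‖X.kernel Φ y z‖ = (X.kernel Φ y z).re := by
  rw [X.kernel_symm Φ y h02 h13 z, Complex.norm_real, Complex.ofReal_re, Real.norm_eq_abs,
    abs_of_nonneg (Complex.normSq_nonneg _)]

/-- **THE WEIGHT OF A COPY WITH NON-SHRINKING SCALARS AT `τ₀`, AGAINST THE MAIN TERM.** -/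
theorem weight_le_of_one_le_norm (D : X.ThetaData) (S : Set (Fin 4 → X.E)) (xm : X.Tuple) (h02 : xm 2 = xm 0)
    (h13 : xm 3 = xm 1) (hint : IntegrableOn (fun z => X.kernel D.Φ xm z) ball) (c : X.CopyData D S xm) (o : X.Orbit)
    (hε : ∀ j, 1 ≤ ‖X.τ₀ (c.rep o j)‖) :
    c.weight o ≤ (∏ j, ‖X.τ₀ (c.rep o j)‖ ^ 2) * ‖c.lam o 0 * c.lam o 1 * conj (c.lam o 2 * c.lam o 3)‖ *
      Real.exp (-(Real.pi * X.defSize (c.rep o) xm)) * (∫ z in ball, X.kernel D.Φ xm z).re := by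
  unfold CopyData.weight
  rw [← X.gaussRatio_eq_exp]
  -- bound the kernel factor
  have hk : ‖∫ z in ball, ((X.kernelScale (c.rep o) xm z : ℝ) : ℂ) * X.kernel D.Φ xm z‖ ≤
      (∏ j, ‖X.τ₀ (c.rep o j)‖ ^ 2) * (∫ z in ball, X.kernel D.Φ xm z).re := by
    refine (norm_integral_le_integral_norm _).trans ?_
    have hre : (∫ z in ball, X.kernel D.Φ xm z).re = ∫ z in ball, ‖X.kernel D.Φ xm z‖ := by
      simp_rw [X.kernel_symm D.Φ xm h02 h13, integral_complex_ofReal, Complex.ofReal_re, Complex.norm_real,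
        Real.norm_of_nonneg (Complex.normSq_nonneg _)]
    rw [hre, ← integral_const_mul]
    refine integral_mono_of_nonneg (Filter.Eventually.of_forall fun z => norm_nonneg _)
      (hint.norm.const_mul _) ?_
    refine ae_restrict_of_forall_mem HeckeEquivariance.isOpen_ball'.measurableSet fun z hz => ?_
    show ‖((X.kernelScale (c.rep o) xm z : ℝ) : ℂ) * X.kernel D.Φ xm z‖ ≤ (∏ j, ‖X.τ₀ (c.rep o j)‖ ^ 2) * ‖X.kernel D.Φ xm z‖
    rw [norm_mul, Complex.norm_real, Real.norm_eq_abs, abs_of_nonneg (X.kernelScale_nonneg _ _ _)]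
    exact mul_le_mul_of_nonneg_right (X.kernelScale_le_of_one_le_norm hε xm hz) (norm_nonneg _)
  calc ‖∫ z in ball, ((X.kernelScale (c.rep o) xm z : ℝ) : ℂ) * X.kernel D.Φ xm z‖ *
        ‖c.lam o 0 * c.lam o 1 * conj (c.lam o 2 * c.lam o 3)‖ * X.gaussRatio (c.rep o) xm
      ≤ ((∏ j, ‖X.τ₀ (c.rep o j)‖ ^ 2) * (∫ z in ball, X.kernel D.Φ xm z).re) *
        ‖c.lam o 0 * c.lam o 1 * conj (c.lam o 2 * c.lam o 3)‖ * X.gaussRatio (c.rep o) xm := by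
          gcongr
          exact (X.gaussRatio_pos _ _).le
    _ = _ := by ring

end T4Data

end Summit.Ventures.HodgeRepro.Tier4.Line3

end
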